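import Literature.NumberTheory.EllipticCurves.KodairaNeronUnramifiedAdditiveBoundProofs
import Literature.NumberTheory.EllipticCurves.NeronComponentIndexTypeIVExact
import Literature.NumberTheory.EllipticCurves.NeronComponentIndexTypeIVstarExact
import Literature.NumberTheory.DiophantineGeometry.ConductorExponentLeEightProofs
import Mathlib.FieldTheory.IsAlgClosed.Basic
import Mathlib.RingTheory.Valuation.Integral
import HarnessLib

/-!
# Kodaira–Néron over `K_v^nr`, types `IV` and `IV*`: the index `[E(K_v^nr) : E₀(K_v^nr)]` is EXACTLY `3`
# (Silverman *ATAEC* IV.9.4 Steps 5 and 8 with Cor. IV.9.2(d), Table 4.1: `c̄(IV) = c̄(IV*) = 3`)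

`Proofs` file (theorems only: no definition, no named fact, no instance), topic
`NumberTheory/EllipticCurves`, sibling of `KodairaNeronUnramifiedAdditiveBoundProofs` /
`KodairaNeronUnramifiedAdditiveThreeProofs` / `KodairaNeronUnramifiedAdditiveCoprimeProofs`.  Those files
compute the index of `E₀` in `J(K_v^nr)` (`J = X₀ ⊗ 𝒪ⁿʳ`, `𝒪ⁿʳ` the henselian discrete valuation ring of
the maximal unramified extension `K_v^nr` inside `K̄_v`) type by type and export `≤ 4`, `3 ∤` off
`IV`/`IV*`, `p ∤` off `p ∣ #Φ(k̄)`; at the types `IV`, `IV*` their computation stops at `{1, 3}`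
(`index_mem_of_normalForm_IV(star)`), because the value `3` needs the Step-5 / Step-8 quadratic
`Y² + γ̄Y − ε̄` (separable: `γ̄² + 4ε̄ ≠ 0`) to SPLIT over the residue field.  Over `𝒪ⁿʳ` it does: a root
`β ∈ K̄_v` of the monic lift `Y² + γY − ε` is integral and simple modulo `𝔪_w`
(`(2β + γ)² = γ² + 4ε` is a unit), hence lies in `K_v^nr` (`mem_maxUnramified_of_isRoot_map`,
Neukirch II (9.11): `K_v^nr` is henselian with separably closed residue field) — the argument of the
tree's `exists_splitNode_root_unrIntegers` (split node at a multiplicative place) for this quadratic.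
With the exact Henselian alternatives `index_eq_three_iff_exists_root_of_normalForm_IV(star)`
(`NeronComponentIndexTypeIV(star)Exact`) this gives the printed value
**`[E(K_v^nr) : E₀(K_v^nr)] = 3 = #Φ(k̄)`** at the types `IV`, `IV*`:

* `exists_root_sq_add_mul_sub_unrIntegers` — for `γ, ε ∈ 𝒪ⁿʳ` with `γ̄² + 4ε̄ ≠ 0` the quadratic
  `Y² + γ̄Y − ε̄` has a root in the residue field of `𝒪ⁿʳ`;
* `index_nonsingularReductionSubgroup_map_eq_three_of_IV_or_IVstar` — `[J(K_v^nr) : E₀] = 3` when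
  Tate's algorithm returns type `IV` or `IV*` on `X₀` (an arbitrary Weierstrass equation over `𝓞_v`
  with `Δ ≠ 0`): the type-`IV`/`IV*` branches of
  `index_nonsingularReductionSubgroup_map_le_four_of_isAdditive` verbatim up to the normal form, then
  the uniformiser factorisations `a₃ = ϖγ, a₆ = ϖ²ε` (resp. `ϖ²γ, ϖ⁴ε`), `γ̄² + 4ε̄ ≠ 0` from `b₆ ∉ 𝔪³`
  (resp. from the two distinct roots of `quadraticStep8`), and the root lemma.

Consumer: the sibling `InertiaFixedTorsionTypeIVProofs` (an inertia-fixed `3`-torsion point off `E₀` at a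
place of type `IV`/`IV*`, `v ∤ 3`, WITHOUT the hypothesis `3 ∣ c_v` of
`InertiaFixedTorsionOfTamagawaProofs`; cell `bsd-ssimc`, crux `KobayashiLowerHalfLargeImage`, line
`shadow_seed`: the `c_q = 1` shadow branch and the Serre exponent `a_v(E[3]) = 1` at EVERY place of type
`IV`/`IV*`).  Nothing is asserted about any curve; BSD is not proved by any of this.

## References

* [SilvermanATAEC1994] J. H. Silverman, *Advanced Topics in the Arithmetic of Elliptic Curves*, GTM 151
  (1994): IV.9.4 Steps 5 and 8 (PDF pp. 344, 346; proofs pp. 348–349, 352–353), Rem. IV.9.3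
  (p. 341), Cor. IV.9.2(d) (p. 340), Table 4.1 (p. 365).
* [SilvermanAEC2009] J. H. Silverman, *The Arithmetic of Elliptic Curves*, 2nd ed. (2009), Thm. VII.6.1.
* [NeukirchANT1999] J. Neukirch, *Algebraic Number Theory* (1999), Ch. II (6.6)–(6.8), Prop. (9.11).

## Design

No definitions; theorems only; conventions, binders and `maxHeartbeats` exactly as in
`KodairaNeronUnramifiedAdditiveBoundProofs` and `KodairaNeronMultiplicativeProofs` (the `𝒪ⁿʳ` of the
tree is `Valuation.valuationSubring (Valuation.comap (algebraMap (maxUnramified K_v) K̄_v) w)`, written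
out; no notation is introduced).  Axioms: `propext`, `Classical.choice`, `Quot.sound`.
-/

noncomputable section

open scoped Classical NNReal
open NumberField IsDedekindDomain Field Polynomial IsLocalRing

universe u

namespace IsDedekindDomain.HeightOneSpectrum

open Literature.NumberTheory.EllipticCurves Literature.NumberTheory.EllipticCurves.LocalIndex
  Literature.NumberTheory.GaloisRepresentations
  Literature.NumberTheory.GaloisRepresentations.IsNonarchimedeanLocalField
  Literature.NumberTheory.DiophantineGeometry Literature.NumberTheory.DiophantineGeometry.TateAlgorithm
  Literature.NumberTheory.DiophantineGeometry.KodairaSymbol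

variable {K : Type u} [Field K] [NumberField K] {v : HeightOneSpectrum (𝓞 K)}
  {w : Valuation (AlgebraicClosure (v.adicCompletion K)) ℝ≥0}
  (hw : ∀ x, (w x : ℝ) = spectralNorm (v.adicCompletion K) (AlgebraicClosure (v.adicCompletion K)) x)

/-! ## A separable monic quadratic over `𝒪ⁿʳ` splits over the residue field of `𝒪ⁿʳ` -/

include hw in
set_option maxHeartbeats 1600000 in
/-- **Over `𝒪ⁿʳ` the Step-5 / Step-8 quadratic has a root in the residue field.**  For `γ, ε` in the
valuation ring `𝒪ⁿʳ` of `K_v^nr ⊂ K̄_v` with `γ̄² + 4ε̄ ≠ 0` (the quadratic `Y² + γ̄Y − ε̄` is separable),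
`Y² + γ̄Y − ε̄` has a root in the residue field of `𝒪ⁿʳ`: a root `β ∈ K̄_v` of the monic `Y² + γY − ε` is
integral, `(2β + γ)² = γ² + 4ε` is a unit, so `β` is a simple root modulo `𝔪_w` and lies in `K_v^nr`
(`mem_maxUnramified_of_isRoot_map`; Neukirch, *ANT*, II §6, (9.11): `K_v^nr` is henselian with separably
closed residue field); its residue is the root.  (The argument of `exists_splitNode_root_unrIntegers`
for this quadratic; Silverman *ATAEC* IV.9.4 Step 5: "`k'` the splitting field over `k` of
`T² + a₃,₁T − a₆,₂`" — over `K_v^nr` one always has `k' = k`.)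
[cite: NeukirchANT1999, Ch. II (6.6)–(6.8) with Prop. (9.11)] [cite: SilvermanATAEC1994, IV.9.4 Step 5 (PDF p. 344)] -/
theorem exists_root_sq_add_mul_sub_unrIntegers
    (γ ε : (Valuation.valuationSubring (Valuation.comap (algebraMap (maxUnramified (v.adicCompletion K)) (AlgebraicClosure (v.adicCompletion K))) w)))
    (hdisc : residue (Valuation.valuationSubring (Valuation.comap (algebraMap (maxUnramified (v.adicCompletion K)) (AlgebraicClosure (v.adicCompletion K))) w)) γ ^ 2 +
      4 * residue (Valuation.valuationSubring (Valuation.comap (algebraMap (maxUnramified (v.adicCompletion K)) (AlgebraicClosure (v.adicCompletion K))) w)) ε ≠ 0) :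
    ∃ r : ResidueField (Valuation.valuationSubring (Valuation.comap (algebraMap (maxUnramified (v.adicCompletion K)) (AlgebraicClosure (v.adicCompletion K))) w)),
      r ^ 2 + residue (Valuation.valuationSubring (Valuation.comap (algebraMap (maxUnramified (v.adicCompletion K)) (AlgebraicClosure (v.adicCompletion K))) w)) γ * r -
        residue (Valuation.valuationSubring (Valuation.comap (algebraMap (maxUnramified (v.adicCompletion K)) (AlgebraicClosure (v.adicCompletion K))) w)) ε = 0 := by
  obtain ⟨ψ, hψ⟩ := exists_ringHom_unrIntegers_integer (w := w) (v := v) (K := K)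
  have hvw : w.Integers w.integer := Valuation.integer.integers w
  have hψinj : Function.Injective ψ := injective_of_coe_eq_coe hψ
  have hψmem : ∀ x : (Valuation.valuationSubring (Valuation.comap (algebraMap (maxUnramified (v.adicCompletion K)) (AlgebraicClosure (v.adicCompletion K))) w)), ((ψ x : w.integer) : (AlgebraicClosure (v.adicCompletion K))) ∈ (maxUnramified (v.adicCompletion K)) := fun x ↦ by
    rw [hψ]; exact (x : (maxUnramified (v.adicCompletion K))).2
  -- `γ² + 4ε` is a unit
  have hunit : IsUnit (γ ^ 2 + 4 * ε) := by
    rw [← IsLocalRing.residue_ne_zero_iff_isUnit]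
    simpa only [map_add, map_pow, map_mul, map_ofNat] using hdisc
  -- the monic quadratic `g = Y² + γ Y - ε`
  set g : ((Valuation.valuationSubring (Valuation.comap (algebraMap (maxUnramified (v.adicCompletion K)) (AlgebraicClosure (v.adicCompletion K))) w)))[X] := X ^ 2 + C γ * X + C (-ε) with hg
  have hgm : g.Monic := by
    rw [hg, add_assoc]
    exact monic_X_pow_add (lt_of_le_of_lt degree_linear_le (by decide))
  have hgdeg : g.degree = 2 := by
    rw [hg, add_assoc, degree_add_eq_left_of_degree_lt] <;> rw [degree_X_pow]
    · rfl
    · exact lt_of_le_of_lt degree_linear_le (by decide)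
  have hgdeg0 : g.degree ≠ 0 := by rw [hgdeg]; decide
  have hgeval : ∀ z : w.integer, g.eval₂ ψ z = z ^ 2 + ψ γ * z + ψ (-ε) := fun z ↦ by
    simp only [hg, eval₂_add, eval₂_mul, eval₂_X_pow, eval₂_C, eval₂_X]
  have hgder : ∀ z : w.integer, (g.map ψ).derivative.eval z = 2 * z + ψ γ := fun z ↦ by
    simp only [hg, Polynomial.map_add, Polynomial.map_mul, Polynomial.map_pow, Polynomial.map_X,
      Polynomial.map_C, derivative_add, derivative_X_pow, derivative_mul, derivative_C,
      derivative_X, zero_mul, mul_one, zero_add, add_zero, eval_add, eval_mul, eval_C, eval_pow,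
      eval_X, Nat.cast_ofNat]
    ring
  -- a root `β ∈ K̄ᵥ`; it is integral
  have hfinj : Function.Injective ((algebraMap w.integer (AlgebraicClosure (v.adicCompletion K))).comp ψ) := hvw.hom_inj.comp hψinj
  obtain ⟨β, hβ⟩ :=
    IsAlgClosed.exists_eval₂_eq_zero_of_injective ((algebraMap w.integer (AlgebraicClosure (v.adicCompletion K))).comp ψ) hfinj g hgdeg0
  have hβ' : (g.map ψ).eval₂ (algebraMap w.integer (AlgebraicClosure (v.adicCompletion K))) β = 0 := by rwa [eval₂_map]
  have hβle : w β ≤ 1 := hvw.isIntegral_iff_v_le_one.mp ⟨g.map ψ, hgm.map ψ, hβ'⟩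
  set b : w.integer := ⟨β, hβle⟩ with hb
  have hbroot : (g.map ψ).IsRoot b := by
    rw [IsRoot.def]
    apply hvw.hom_inj
    rw [map_zero, ← eval_map_apply, eval_map]
    exact hβ'
  have hbrel : b ^ 2 + ψ γ * b + ψ (-ε) = 0 := by
    have h := hbroot
    rwa [IsRoot.def, eval_map, hgeval] at h
  -- `g'(β) = 2β + γ` is a unit: `(2β + γ)² = γ² + 4ε`
  have hsq : (2 * b + ψ γ) ^ 2 = ψ (γ ^ 2 + 4 * ε) := by
    rw [map_add, map_pow, map_mul, map_ofNat]
    rw [map_neg] at hbrel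
    linear_combination (4 : w.integer) * hbrel
  have hder : IsUnit ((g.map ψ).derivative.eval b) := by
    rw [hgder]
    have h1 : IsUnit ((2 * b + ψ γ) ^ 2) := by rw [hsq]; exact hunit.map ψ
    exact (isUnit_pow_iff two_ne_zero).mp h1
  -- hence `β ∈ K_v^nr`, i.e. `β = ψ b'` with `b' ∈ 𝒪ⁿʳ`
  have hβnr : (β : (AlgebraicClosure (v.adicCompletion K))) ∈ (maxUnramified (v.adicCompletion K)) := mem_maxUnramified_of_isRoot_map hw hψmem g hbroot hder
  have hble : (⟨β, hβnr⟩ : (maxUnramified (v.adicCompletion K))) ∈ ((Valuation.valuationSubring (Valuation.comap (algebraMap (maxUnramified (v.adicCompletion K)) (AlgebraicClosure (v.adicCompletion K))) w))) := by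
    rw [Valuation.mem_valuationSubring_iff, comap_maxUnramified_apply]
    exact hβle
  set b' : (Valuation.valuationSubring (Valuation.comap (algebraMap (maxUnramified (v.adicCompletion K)) (AlgebraicClosure (v.adicCompletion K))) w)) := ⟨⟨β, hβnr⟩, hble⟩ with hb'
  have hψb' : ψ b' = b := Subtype.ext (by rw [hψ])
  have hroot : b' ^ 2 + γ * b' - ε = 0 := by
    apply hψinj
    rw [map_sub, map_add, map_mul, map_pow, hψb', map_zero, sub_eq_add_neg, ← map_neg]
    exact hbrel
  refine ⟨residue (Valuation.valuationSubring (Valuation.comap (algebraMap (maxUnramified (v.adicCompletion K)) (AlgebraicClosure (v.adicCompletion K))) w)) b', ?_⟩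
  have key' := congrArg (residue (Valuation.valuationSubring (Valuation.comap (algebraMap (maxUnramified (v.adicCompletion K)) (AlgebraicClosure (v.adicCompletion K))) w))) hroot
  simpa only [map_sub, map_add, map_mul, map_pow, map_zero] using key'

/-! ## The local index over `𝒪ⁿʳ` at the types `IV`, `IV*` is exactly `3` -/

set_option maxHeartbeats 4000000 in
include hw in
/-- **`[J(K_v^nr) : E₀] = 3` when Tate's algorithm returns type `IV` or `IV*` on `X₀`** (`J = X₀ ⊗ 𝒪ⁿʳ`,
`X₀` an arbitrary Weierstrass equation over `𝓞_v` with `Δ ≠ 0`): Silverman, *ATAEC* Cor. IV.9.2(d) with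
Table 4.1 (`c̄(IV) = c̄(IV*) = 3`) over the henselian discrete valuation ring `𝒪ⁿʳ` of `K_v^nr`, where
the Step-5 / Step-8 alternative "`c = 3` if `k' = k`, `c = 1` if `k' ≠ k`" always takes the first branch
(`exists_root_sq_add_mul_sub_unrIntegers`).  The `IV`/`IV*` branches of
`index_nonsingularReductionSubgroup_map_le_four_of_isAdditive` verbatim up to the normal form
(`exists_smul_of_kodairaSymbolOfMinimal_eq_IV(star)` over `𝓞_v`, transported along the unramified
`φ : 𝓞_v → 𝒪ⁿʳ`), then `a₃ = ϖγ`, `a₆ = ϖ²ε` (resp. `ϖ²γ`, `ϖ⁴ε`) with `ϖ` a uniformiser of `𝒪ⁿʳ`,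
`γ̄² + 4ε̄ ≠ 0` from `b₆ = ϖ²(γ² + 4ε) ∉ 𝔪³` (resp. from the two distinct roots of `quadraticStep8`), and
`index_eq_three_iff_exists_root_of_normalForm_IV(star)`.
[cite: SilvermanATAEC1994, Cor. IV.9.2(d) with IV.9.4 Steps 5, 8 and Table 4.1 (PDF pp. 340–346, 365)]
[cite: SilvermanAEC2009, Thm. VII.6.1 (PDF p. 177)] -/
theorem index_nonsingularReductionSubgroup_map_eq_three_of_IV_or_IVstar
    [IsDiscreteValuationRing (Valuation.valuationSubring (Valuation.comap (algebraMap (maxUnramified (v.adicCompletion K)) (AlgebraicClosure (v.adicCompletion K))) w))] [HenselianLocalRing (Valuation.valuationSubring (Valuation.comap (algebraMap (maxUnramified (v.adicCompletion K)) (AlgebraicClosure (v.adicCompletion K))) w))]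
    {φ : (v.adicCompletionIntegers K) →+* (Valuation.valuationSubring (Valuation.comap (algebraMap (maxUnramified (v.adicCompletion K)) (AlgebraicClosure (v.adicCompletion K))) w))} (hφ : ∀ a, (((φ a : (Valuation.valuationSubring (Valuation.comap (algebraMap (maxUnramified (v.adicCompletion K)) (AlgebraicClosure (v.adicCompletion K))) w))) : (maxUnramified (v.adicCompletion K))) : (AlgebraicClosure (v.adicCompletion K))) = algebraMap (v.adicCompletion K) (AlgebraicClosure (v.adicCompletion K)) (a : (v.adicCompletion K)))
    (X₀ : WeierstrassCurve (v.adicCompletionIntegers K)) (hΔ : X₀.Δ ≠ 0)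
    (hs : X₀.kodairaSymbolOfMinimal = KodairaSymbol.IV ∨ X₀.kodairaSymbolOfMinimal = KodairaSymbol.IVstar) :
    letI : DecidableEq (maxUnramified (v.adicCompletion K)) := fun a b ↦ Classical.propDecidable (a = b)
    ((X₀.map φ).nonsingularReductionSubgroup (integers_valuationRing_valuation (Valuation.valuationSubring (Valuation.comap (algebraMap (maxUnramified (v.adicCompletion K)) (AlgebraicClosure (v.adicCompletion K))) w)) (maxUnramified (v.adicCompletion K)))).index = 3 := by
  letI instDec : DecidableEq (maxUnramified (v.adicCompletion K)) := fun a b ↦ Classical.propDecidable (a = b)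
  haveI : PerfectField (ResidueField (v.adicCompletionIntegers K)) := PerfectField.ofFinite
  have hvR := integers_valuationRing_valuation (Valuation.valuationSubring (Valuation.comap (algebraMap (maxUnramified (v.adicCompletion K)) (AlgebraicClosure (v.adicCompletion K))) w)) (maxUnramified (v.adicCompletion K))
  show ((X₀.map φ).nonsingularReductionSubgroup hvR).index = 3
  -- transfer of the `π`-adic conditions
  have T : ∀ (a : (v.adicCompletionIntegers K)) (k : ℕ), a ∈ maximalIdeal (v.adicCompletionIntegers K) ^ k → φ a ∈ maximalIdeal (Valuation.valuationSubring (Valuation.comap (algebraMap (maxUnramified (v.adicCompletion K)) (AlgebraicClosure (v.adicCompletion K))) w)) ^ k :=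
    fun a k h ↦ (map_mem_maximalIdeal_pow_iff hw hφ a k).mpr h
  have T1 : ∀ a : (v.adicCompletionIntegers K), a ∈ maximalIdeal (v.adicCompletionIntegers K) → φ a ∈ maximalIdeal (Valuation.valuationSubring (Valuation.comap (algebraMap (maxUnramified (v.adicCompletion K)) (AlgebraicClosure (v.adicCompletion K))) w)) :=
    fun a h ↦ (map_mem_maximalIdeal_iff hw hφ a).mpr h
  have N : ∀ (a : (v.adicCompletionIntegers K)) (k : ℕ), a ∉ maximalIdeal (v.adicCompletionIntegers K) ^ k → φ a ∉ maximalIdeal (Valuation.valuationSubring (Valuation.comap (algebraMap (maxUnramified (v.adicCompletion K)) (AlgebraicClosure (v.adicCompletion K))) w)) ^ k :=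
    fun a k h h' ↦ h ((map_mem_maximalIdeal_pow_iff hw hφ a k).mp h')
  have hΔφ : ∀ D : WeierstrassCurve.VariableChange (v.adicCompletionIntegers K), ((D • X₀).map φ).Δ ≠ 0 := fun D h0 ↦ by
    rw [WeierstrassCurve.map_Δ, WeierstrassCurve.variableChange_Δ, map_mul,
      mul_eq_zero] at h0
    rcases h0 with h0 | h0
    · exact (((D.u⁻¹ ^ 12).isUnit.map φ).ne_zero) (by simpa using h0)
    · exact hΔ (injective_of_coe_eq_algebraMap hφ (by rw [h0, map_zero]))
  have hidx : ∀ D : WeierstrassCurve.VariableChange (v.adicCompletionIntegers K),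
      (((D • X₀).map φ).nonsingularReductionSubgroup hvR).index =
      ((X₀.map φ).nonsingularReductionSubgroup hvR).index := fun D ↦ by
    rw [← WeierstrassCurve.map_variableChange]
    exact index_nonsingularReductionSubgroup_smul (X₀.map φ) (D.map φ)
  -- a uniformiser of `𝒪ⁿʳ`
  have hϖ : Irreducible (uniformizer (Valuation.valuationSubring (Valuation.comap (algebraMap (maxUnramified (v.adicCompletion K)) (AlgebraicClosure (v.adicCompletion K))) w))) := irreducible_uniformizer
  set ϖ := uniformizer (Valuation.valuationSubring (Valuation.comap (algebraMap (maxUnramified (v.adicCompletion K)) (AlgebraicClosure (v.adicCompletion K))) w)) with hϖdef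
  rcases hs with hs' | hs'
  · -- type `IV`
    obtain ⟨D, h1, h2, h3, h4, h6, hb₆⟩ := exists_smul_of_kodairaSymbolOfMinimal_eq_IV X₀ hs'
    set J := (D • X₀).map φ with hJ
    have hb₆' : J.b₆ ∉ maximalIdeal (Valuation.valuationSubring (Valuation.comap (algebraMap (maxUnramified (v.adicCompletion K)) (AlgebraicClosure (v.adicCompletion K))) w)) ^ 3 := by
      rw [hJ, WeierstrassCurve.map_b₆]; exact N _ 3 hb₆
    have h3' : J.a₃ ∈ maximalIdeal _ := by rw [hJ, WeierstrassCurve.map_a₃]; exact T1 _ h3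
    have h6' : J.a₆ ∈ maximalIdeal _ ^ 2 := by rw [hJ, WeierstrassCurve.map_a₆]; exact T _ 2 h6
    obtain ⟨γ, hγ⟩ := mem_maximalIdeal_iff_dvd.mp h3'
    obtain ⟨ε, hε⟩ := mem_maximalIdeal_pow_iff_dvd.mp h6'
    have hγ' : J.a₃ = ϖ * γ := hγ
    have hε' : J.a₆ = ϖ ^ 2 * ε := hε
    have hdisc : residue _ γ ^ 2 + 4 * residue _ ε ≠ 0 := by
      intro h0
      apply hb₆'
      have hm : γ ^ 2 + 4 * ε ∈ maximalIdeal (Valuation.valuationSubring (Valuation.comap (algebraMap (maxUnramified (v.adicCompletion K)) (AlgebraicClosure (v.adicCompletion K))) w)) := by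
        rw [← IsLocalRing.residue_eq_zero_iff]
        simpa only [map_add, map_pow, map_mul, map_ofNat] using h0
      have hb : J.b₆ = ϖ ^ 2 * (γ ^ 2 + 4 * ε) := by
        rw [WeierstrassCurve.b₆, hγ', hε']; ring
      rw [hb, pow_succ _ 2]
      exact Ideal.mul_mem_mul (Ideal.pow_mem_pow ((IsLocalRing.mem_maximalIdeal _).mpr hϖ.not_isUnit) 2) hm
    obtain ⟨r, hr⟩ := exists_root_sq_add_mul_sub_unrIntegers hw γ ε hdisc
    have key := (index_eq_three_iff_exists_root_of_normalForm_IV (K := (maxUnramified (v.adicCompletion K))) J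
      (by rw [hJ, WeierstrassCurve.map_a₁]; exact T1 _ h1)
      (by rw [hJ, WeierstrassCurve.map_a₂]; exact T1 _ h2) hϖ hγ'
      (by rw [hJ, WeierstrassCurve.map_a₄]; exact T _ 2 h4) hε' hdisc (hΔφ D)).mpr ⟨r, hr⟩
    rw [hJ, hidx] at key
    exact key
  · -- type `IV*`
    obtain ⟨D, h1, h2, h3, h4, h6, h8⟩ := exists_smul_of_kodairaSymbolOfMinimal_eq_IVstar X₀ hs'
    have h8' := distinctRootCount_quadraticStep8_map_eq_two hw hφ (D • X₀) h3 h6 h8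
    set J := (D • X₀).map φ with hJ
    have h3' : J.a₃ ∈ maximalIdeal _ ^ 2 := by rw [hJ, WeierstrassCurve.map_a₃]; exact T _ 2 h3
    have h6' : J.a₆ ∈ maximalIdeal _ ^ 4 := by rw [hJ, WeierstrassCurve.map_a₆]; exact T _ 4 h6
    obtain ⟨γ, hγ⟩ := mem_maximalIdeal_pow_iff_dvd.mp h3'
    obtain ⟨ε, hε⟩ := mem_maximalIdeal_pow_iff_dvd.mp h6'
    have hγ' : J.a₃ = ϖ ^ 2 * γ := hγ
    have hε' : J.a₆ = ϖ ^ 4 * ε := hε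
    have hdisc : residue _ γ ^ 2 + 4 * residue _ ε ≠ 0 := by
      rw [quadraticStep8_eq hγ' hε'] at h8'
      exact CharTwo.sq_add_four_mul_ne_zero_of_distinctRootCount_eq_two _ _ h8'
    obtain ⟨r, hr⟩ := exists_root_sq_add_mul_sub_unrIntegers hw γ ε hdisc
    have key := (index_eq_three_iff_exists_root_of_normalForm_IVstar (K := (maxUnramified (v.adicCompletion K))) J
      (by rw [hJ, WeierstrassCurve.map_a₁]; exact T1 _ h1)
      (by rw [hJ, WeierstrassCurve.map_a₂]; exact T _ 2 h2) hϖ hγ'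
      (by rw [hJ, WeierstrassCurve.map_a₄]; exact T _ 3 h4) hε' hdisc (hΔφ D)).mpr ⟨r, hr⟩
    rw [hJ, hidx] at key
    exact key

end IsDedekindDomain.HeightOneSpectrum

end
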